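import Mathlib
import HarnessLib
import Summits.ResolutionOfSingularities.ResolutionOfSingularities.Theorems.WildQuotientsWildQuotientResolutionS1aKillLeast
import Summits.ResolutionOfSingularities.ResolutionOfSingularities.Theorems.WildQuotientsWildQuotientResolutionS1aWeightedQuasiRegular

/-!
# S1a — K-LEAST and K-U for regular competitors (SIG v2 §3 / §4 of plan-1's `W45cKUniqSig.lean`)

[OURS · L1 W4.5c · lead-1 g10; plan-1 ASSIGNMENT v10.27 item (1)] — NOT statements of the manuscript; counted 0; AI-level work, weaker than expert review. Crux
stmt-ResolutionOfSingularities-17941 `CyclicQuotientFourfolds`, line `s1a-logminvertex` v10, K-side (`stub_killTouchReachAux`). Route-independent; pure algebra.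

The abstract K-LEAST (`weightedFiltration_le_of_kill_of_filtration`, competitor = any multiplicative filtration with reduced associated graded ring) specialised to the
SIG's competitor, the weighted filtration `𝒥(f', w')` of a WEAKLY REGULAR sequence `f'` with `B ⧸ (f')` reduced and positive weights (GR-RED supplied by
`mem_weightedFiltration_of_pow_mem_of_isWeaklyRegular`). Compared with the SIG: no `IsNoetherianRing B`, `IsWeaklyRegular` instead of `IsRegular`.
* ★★★ `weightedFiltration_le_of_kill_of_admissible` — **K-LEAST** (SIG §3): `n·δ ≤ k·δ' ⇒ 𝒥ₖ(f,w) ≤ 𝒥ₙ(f',w')`;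
* ★★★ `weightedFiltration_veronese_eq_of_kills` — **K-U** (SIG §4): two irrelevant σ-admissible regular weighted centres with the same centre ideal define the same
  Rees filtration up to Veronese, `𝒥_{kδ}(f,w) = 𝒥_{kδ'}(f',w')` — the agreement hypothesis of the cover theorems (p639213 / p639895 / p644505) for irrelevant kill charts
  with a common centre, after scaling to a common shift.
-/

set_option linter.dupNamespace false

noncomputable section

open Literature.AlgebraicGeometry.Resolution
open scoped LaurentPolynomial
open Summit.ResolutionOfSingularities.ResolutionOfSingularities.Theorems.WildQuotientResolution.S1.CoarseChart

namespace Summit.ResolutionOfSingularities.ResolutionOfSingularities.Theorems.WildQuotientResolution.S1.KillCert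

universe u

variable {B : Type u} [CommRing B]

/-- `(f') ≤ 𝒥₁(f', w')` for positive weights. [folklore] -/
theorem span_le_weightedFiltration_one {c' : ℕ} (f' : Fin c' → B) (w' : Fin c' → ℕ) (hw' : ∀ i, 0 < w' i) :
    Ideal.span (Set.range f') ≤ (weightedFiltration f' w').ideal 1 := by
  have := span_mul_weightedFiltration_le f' w' hw' 0
  rwa [(weightedFiltration f' w').ideal_zero, Ideal.mul_top] at this

/-- ★★★ **K-LEAST** (SIG v2 §3). Let `β` be a non-zero-divisor, `(f, w, δ)` (`δ > 0`) a σ-admissible ((a′)_δ) weighted centre with IRRELEVANT shifted initial ideal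
((i)_δ), and `(f', w', δ')` a σ-admissible ((a′)_δ') weighted centre with `f'` weakly regular, `B ⧸ (f')` reduced, positive weights and `(f) ≤ (f')`. Then the
normalised kill filtration is the SMALLER one: `n·δ ≤ k·δ' ⇒ 𝒥ₖ(f,w) ≤ 𝒥ₙ(f',w')`. No regularity on `f`, no Noetherian hypothesis.
[OURS · L1 W4.5c · K-UNIQ v2 §A; NOT a statement of the manuscript] -/
theorem weightedFiltration_le_of_kill_of_admissible (σ : B ≃+* B) (β : B) (hβ : β ∈ nonZeroDivisors B) {p : ℕ} (hp : 0 < p)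
    (hσp : ∀ x : B, (⇑σ)^[p] x = x) {c c' : ℕ} (f : Fin c → B) (f' : Fin c' → B) (w : Fin c → ℕ) (w' : Fin c' → ℕ) (δ δ' : ℕ) (hδ : 0 < δ)
    (hw' : ∀ i, 0 < w' i) (hI : Ideal.span (Set.range f) ≤ Ideal.span (Set.range f'))
    (hreg' : RingTheory.Sequence.IsWeaklyRegular B (List.ofFn f')) (hred' : IsReduced (B ⧸ Ideal.span (Set.range f')))
    (hσJ : ∀ n : ℕ, ((weightedFiltration f w).ideal n).map (σ : B →+* B) ≤ (weightedFiltration f w).ideal n)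
    (hadm : ∀ (n : ℕ) (y : B), y ∈ (weightedFiltration f w).ideal n →
      σ y - y ∈ Ideal.span {β} * (weightedFiltration f w).ideal (n + δ))
    (hirr : ∃ N : ℕ, cobordantAlgebra.vertexIdeal f w ^ N ≤
      (augmentationIdeal (sigmaR σ f w hσJ hp hσp)).colon
          (Ideal.span {algebraMap B (↥(cobordantAlgebra f w)) β * cobordantAlgebra.s f w ^ δ}) ⊔
        cobordantAlgebra.excIdeal f w)
    (hadm' : ∀ (n : ℕ) (y : B), y ∈ (weightedFiltration f' w').ideal n →
      σ y - y ∈ Ideal.span {β} * (weightedFiltration f' w').ideal (n + δ'))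
    (n k : ℕ) (hnk : n * δ ≤ k * δ') :
    (weightedFiltration f w).ideal k ≤ (weightedFiltration f' w').ideal n :=
  weightedFiltration_le_of_kill_of_filtration f w σ hσJ hp hσp β hβ δ δ' hδ hadm hirr (weightedFiltration f' w')
    (fun y N m _ hy => mem_weightedFiltration_of_pow_mem_of_isWeaklyRegular f' w' hw' hreg' hred' y N m hy)
    (fun t => span_le_weightedFiltration_one f' w' hw' (hI (Ideal.subset_span ⟨t, rfl⟩))) hadm' n k hnk

/-- ★★★ **K-U — FRAME-FREE UNIQUENESS OF THE KILL FILTRATION** (SIG v2 §4). Two weighted centres `(f, w, δ)`, `(f', w', δ')` (`δ, δ' > 0`, positive weights) with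
the SAME centre ideal, both weakly regular with reduced quotient, both σ-admissible for the boundary `β` (a non-zero-divisor) and both with IRRELEVANT shifted
initial ideal define the same Rees filtration up to Veronese: `𝒥_{kδ}(f,w) = 𝒥_{kδ'}(f',w')` (§3 both ways). [OURS · L1 W4.5c · K-UNIQ v2; NOT a statement of the
manuscript] -/
theorem weightedFiltration_veronese_eq_of_kills (σ : B ≃+* B) (β : B) (hβ : β ∈ nonZeroDivisors B) {p : ℕ} (hp : 0 < p)
    (hσp : ∀ x : B, (⇑σ)^[p] x = x) {c c' : ℕ} (f : Fin c → B) (f' : Fin c' → B) (w : Fin c → ℕ) (w' : Fin c' → ℕ) (δ δ' : ℕ)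
    (hδ : 0 < δ) (hδ' : 0 < δ') (hw : ∀ i, 0 < w i) (hw' : ∀ i, 0 < w' i)
    (hI : Ideal.span (Set.range f') = Ideal.span (Set.range f))
    (hreg : RingTheory.Sequence.IsWeaklyRegular B (List.ofFn f)) (hreg' : RingTheory.Sequence.IsWeaklyRegular B (List.ofFn f'))
    (hred : IsReduced (B ⧸ Ideal.span (Set.range f)))
    (hσJ : ∀ n : ℕ, ((weightedFiltration f w).ideal n).map (σ : B →+* B) ≤ (weightedFiltration f w).ideal n)
    (hσJ' : ∀ n : ℕ, ((weightedFiltration f' w').ideal n).map (σ : B →+* B) ≤ (weightedFiltration f' w').ideal n)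
    (hadm : ∀ (n : ℕ) (y : B), y ∈ (weightedFiltration f w).ideal n →
      σ y - y ∈ Ideal.span {β} * (weightedFiltration f w).ideal (n + δ))
    (hadm' : ∀ (n : ℕ) (y : B), y ∈ (weightedFiltration f' w').ideal n →
      σ y - y ∈ Ideal.span {β} * (weightedFiltration f' w').ideal (n + δ'))
    (hirr : ∃ N : ℕ, cobordantAlgebra.vertexIdeal f w ^ N ≤
      (augmentationIdeal (sigmaR σ f w hσJ hp hσp)).colon
          (Ideal.span {algebraMap B (↥(cobordantAlgebra f w)) β * cobordantAlgebra.s f w ^ δ}) ⊔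
        cobordantAlgebra.excIdeal f w)
    (hirr' : ∃ N : ℕ, cobordantAlgebra.vertexIdeal f' w' ^ N ≤
      (augmentationIdeal (sigmaR σ f' w' hσJ' hp hσp)).colon
          (Ideal.span {algebraMap B (↥(cobordantAlgebra f' w')) β * cobordantAlgebra.s f' w' ^ δ'}) ⊔
        cobordantAlgebra.excIdeal f' w') (k : ℕ) :
    (weightedFiltration f w).ideal (k * δ) = (weightedFiltration f' w').ideal (k * δ') := by
  have hred' : IsReduced (B ⧸ Ideal.span (Set.range f')) := by rw [hI]; exact hred
  refine le_antisymm ?_ ?_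
  · exact weightedFiltration_le_of_kill_of_admissible σ β hβ hp hσp f f' w w' δ δ' hδ hw' hI.ge hreg' hred' hσJ hadm hirr hadm'
      (k * δ') (k * δ) (by rw [Nat.mul_right_comm])
  · exact weightedFiltration_le_of_kill_of_admissible σ β hβ hp hσp f' f w' w δ' δ hδ' hw hI.le hreg hred hσJ' hadm' hirr' hadm
      (k * δ) (k * δ') (by rw [Nat.mul_right_comm])

end Summit.ResolutionOfSingularities.ResolutionOfSingularities.Theorems.WildQuotientResolution.S1.KillCert

end
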